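import Summits.BirchSwinnertonDyer.BirchSwinnertonDyer.Theorems.CMKolyvaginAtInertTwoPairAssemblyCMInertOfKillAtTwo
import Summits.BirchSwinnertonDyer.BirchSwinnertonDyer.Theorems.CMKolyvaginAtInertTwoPairAssemblyCardBridgeAtTwo
import Summits.BirchSwinnertonDyer.BirchSwinnertonDyer.Theorems.CMKolyvaginAtInertTwoShaCountHalvesAtTwo
import HarnessLib

/-!
# Route `CMKolyvaginAtInertTwo`, crux `CMKolyvaginExactAtInertTwo` (stmt-BirchSwinnertonDyer-24277):
# THE PATH-(β) T2 ASSEMBLY READ IN THE COUNT IDENTITY'S CURRENCY — `#Ш(E)[2^∞] · #Ш(E^{(d_K)})[2^∞] ≤ 2^{2M₀}` on H₂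
# (the hypothesis `hpair` of g16's `card_primaryComponent_sha_two_baseChange_le_pow_of_pair_le_of_facts`)

Seat `bsd-line-cmk2-p1` g17 (cell `bsd-print-cf2`); helper (`--supports stmt-BirchSwinnertonDyer-24277`).
THEOREMS ONLY: no definition, no named fact, no `sorry`; no item is closed; BSD is not proved by this.

`card_mul_card_le_two_pow_two_mul_of_pairData_cmInert_of_finite` (p721644) gives `#Ш(E)[2^L] · #Sel_{2^{2L}}(E^{(d_K)}) ≤ 2^{2M₀}`.
Here it is read as `#Ш(E)(2) · #Ш(E^{(d_K)})(2) ≤ 2^{2M₀}` (`AddCommGroup.primaryComponent · 2`): `Sel_{2^{2L}}(E^{(d_K)}) ≅ Ш(E^{(d_K)})[2^L]`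
(`ι₂` injective by `hinjT`, onto by `selmerToSha_surjective`, p716506) and `A[2^L] = A(2)` when `#A(2) ∣ 2^L` (p715866), the latter from
`v₂ #A ≤ L` (`torsionBy_two_pow_eq_primaryComponent_of_padicValNat_le`: an element of order `2^j` has `2^j ∣ #A`). The output is VERBATIM the hypothesis `hpair` of
g16's `ShaCountTwo.card_primaryComponent_sha_two_baseChange_le_pow_of_pair_le_of_facts` (p705380; `twin W K = W.quadraticTwist d_K`), which
turns it into the registered `stub_upper` conclusion `#Ш(E_K)(2) ≤ 2^{2M₀}` (prime `|d_K|`, modulo GZ/GZK/modularity/Milne).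

* `torsionBy_two_pow_eq_primaryComponent_of_padicValNat_le`, `natCard_torsionBy_two_pow_eq_of_padicValNat_le`,
  `card_primaryComponent_mul_le_two_pow_of_pairData_cmInert`;
* `card_primaryComponent_sha_two_baseChange_le_pow_of_pairData_cmInert_of_facts` — composed with p705380: **the registered
  `stub_upper` conclusion `#Ш(E_K)(2) ≤ 2^{2·D.M₀}` modulo the route's facts and the supplier's inputs**.

References: [McCallumLMS1991] §1 Theorem, §5 Thm. 5.4, Cor. 5.6; [Kolyvagin1989Izv] §3; [MilneADT2006] I §6.
-/

-- single-conjunct summit: `Summit.BirchSwinnertonDyer.BirchSwinnertonDyer.…` repeats the name by design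
set_option linter.dupNamespace false
set_option autoImplicit false

noncomputable section

open scoped Classical
open scoped AddSubgroup
open WeierstrassCurve NumberField IsDedekindDomain Field Function Rat.HeightOneSpectrum
open Literature.NumberTheory.GaloisRepresentations
open Literature.NumberTheory.GaloisCohomology
open Literature.NumberTheory.EllipticCurves Literature.NumberTheory.EllipticCurves.KolyvaginDescent
open Summit.BirchSwinnertonDyer.BirchSwinnertonDyer.Theorems.GenusExact.EigenClassesFinite
open Summit.BirchSwinnertonDyer.BirchSwinnertonDyer.Theorems.GenusExact.VisiblePairAtTwo

namespace Summit.BirchSwinnertonDyer.BirchSwinnertonDyer.Theorems.KolyvaginPairDataTwo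

/-- **`A[2^L] = A(2)` for a finite additive group `A` with `v₂ #A ≤ L`**: an element of `2`-power order `2^j` has `2^j ∣ #A`,
so `j ≤ v₂ #A ≤ L`. [cite: McCallumLMS1991, §1 (Ш[p^∞] and its order)] -/
theorem torsionBy_two_pow_eq_primaryComponent_of_padicValNat_le {A : Type*} [AddCommGroup A] [Finite A] {L : ℕ}
    (hL : padicValNat 2 (Nat.card A) ≤ L) : A[(2 ^ L : ℕ)] = AddCommGroup.primaryComponent A 2 := by
  ext x
  rw [AddSubgroup.torsionBy.nsmul_iff, AddCommGroup.mem_primaryComponent]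
  constructor
  · exact fun h ↦ ⟨L, h⟩
  · rintro ⟨k, hk⟩
    have h1 : addOrderOf x ∣ 2 ^ k := addOrderOf_dvd_iff_nsmul_eq_zero.mpr hk
    obtain ⟨j, -, hj⟩ := (Nat.dvd_prime_pow Nat.prime_two).mp h1
    have h2 : 2 ^ j ∣ Nat.card A := hj ▸ addOrderOf_dvd_natCard x
    have h3 : j ≤ L := le_trans ((padicValNat_dvd_iff_le Nat.card_pos.ne').mp h2) hL
    exact addOrderOf_dvd_iff_nsmul_eq_zero.mp (hj ▸ pow_dvd_pow 2 h3)

/-- `#A[2^L] = #A(2)` under the same hypothesis. [cite: McCallumLMS1991, §1 (Ш[p^∞] and its order)] -/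
theorem natCard_torsionBy_two_pow_eq_of_padicValNat_le {A : Type*} [AddCommGroup A] [Finite A] {L : ℕ}
    (hL : padicValNat 2 (Nat.card A) ≤ L) :
    Nat.card (A[(2 ^ L : ℕ)]) = Nat.card (AddCommGroup.primaryComponent A 2) := by
  rw [torsionBy_two_pow_eq_primaryComponent_of_padicValNat_le hL]

variable (W : WeierstrassCurve ℚ) {K : Type} [Field K] [NumberField K]

set_option maxHeartbeats 1600000 in
/-- **`#Ш(E)(2) · #Ш(E^{(d_K)})(2) ≤ 2^{2M₀}` on H₂** from the two-member descent data, a Heegner point, the finiteness of the two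
Tate–Shafarevich groups (`v₂ #Ш ≤ L`) and the point-free Mordell–Weil kernels — verbatim the input `hpair` of g16's halves theorem
(p705380). [cite: McCallumLMS1991, §5 Thm. 5.4, Cor. 5.6] [cite: Kolyvagin1989Izv, §3] -/
theorem card_primaryComponent_mul_le_two_pow_of_pairData_cmInert
    [W.IsElliptic] [W.IsGloballyMinimal] [NeZero (W.conductorNorm ℤ)] [(twin W K).IsElliptic]
    (hCM : W.HasCM) (hin : Literature.NumberTheory.EllipticCurves.Rank1Residual.CMInert W 2)
    (hρ : W.HasSurjectiveModNGaloisRep 2) (hK : IsImaginaryQuadratic K) (hoddK : Odd (NumberField.discr K))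
    (hH : SatisfiesHeegnerHypothesis (W.conductorNorm ℤ) K)
    {P₀ : (W.baseChange K).toAffine.Point} (hP₀ : IsHeegnerPoint (W.conductorNorm ℤ) W K P₀)
    {L : ℕ} (hL1 : 1 ≤ L)
    -- the two-member descent data on the `ℚ`-pair carrier
    (D : PairDataM (galH1Torsion W (lvl (L + L))) (galH1Torsion (twin W K) (lvl (L + L)))
      (HeightOneSpectrum (𝓞 ℚ) ⊕ InfinitePlace ℚ))
    (hDp : D.p = 2) (hDM : D.M = L + L)
    (hDSel₁ : D.Sel₁ = selmerGroup W (lvl (L + L)))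
    (hDSel₂ : D.Sel₂ = selmerGroup (twin W K) (lvl (L + L)))
    (hDLoc₁ : D.Loc₁ = loc₁ W (L + L)) (hDLoc₂ : D.Loc₂ = loc₂ W K (L + L))
    (hDA₁ : D.A₁ = a₁ W (L + L)) (hDA₂ : D.A₂ = a₂ W K (L + L))
    (hDpl : D.pl = pl) (hDDv : D.Dv = Dv)
    (hDKol : ∀ ℓ, D.Kol ℓ ↔ IsKolyvaginPrime (W.conductorNorm ℤ) W K 2 ℓ ∧
      FrobEqFrobInfty W K (2 ^ (L + L + 1)) ℓ ∧ kolPrime W K (L + L) ℓ)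
    (hM₀L : D.M₀ ≤ L)
    -- finiteness of the two Tate–Shafarevich groups, `L` beyond their `2`-adic size
    [Finite W.sha] [Finite (twin W K).sha]
    (hLsha₁ : padicValNat 2 (Nat.card W.sha) ≤ L) (hLsha₂ : padicValNat 2 (Nat.card (twin W K).sha) ≤ L)
    -- rank one on `E`: the kernel of `Sel_{2^{2L}}(E) → H¹(ℚ, E)` is `ℤ · D.x`; rank zero on `E^{(d_K)}`: that kernel vanishes
    (hkerT : ∀ z : selmerGroup W (lvl (L + L)),
      torsionH1ToH1 W (lvl (L + L)) z = 0 ↔ (z : galH1Torsion W (lvl (L + L))) ∈ AddSubgroup.zmultiples D.x)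
    (hinjT : ∀ z : selmerGroup (twin W K) (lvl (L + L)), torsionH1ToH1 (twin W K) (lvl (L + L)) z = 0 → z = 0) :
    Nat.card (AddCommGroup.primaryComponent W.sha 2) *
      Nat.card (AddCommGroup.primaryComponent (twin W K).sha 2) ≤ 2 ^ (2 * D.M₀) := by
  have h := card_mul_card_le_two_pow_two_mul_of_pairData_cmInert_of_finite W hCM hin hρ hK hoddK hH hP₀ hL1 D hDp hDM hDSel₁
    hDSel₂ hDLoc₁ hDLoc₂ hDA₁ hDA₂ hDpl hDDv hDKol hM₀L hLsha₁ hLsha₂ hkerT hinjT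
  -- `Sel_{2^{2L}}(E^{(d_K)}) ≅ Ш(E^{(d_K)})[2^L]`
  obtain ⟨ι₂, hι₂⟩ := exists_selmerToSha_of_finite (twin W K) hLsha₂
  have hinj : Function.Injective ι₂ := by
    refine (injective_iff_map_eq_zero ι₂).mpr fun z hz ↦ hinjT z ?_
    rw [← hι₂ z, hz]
    rfl
  have hcard₂ : Nat.card (selmerGroup (twin W K) (lvl (L + L))) = Nat.card (((twin W K).sha)[(2 ^ L : ℕ)]) :=
    Nat.card_congr (Equiv.ofBijective ι₂ ⟨hinj, selmerToSha_surjective (twin W K) ι₂ hι₂⟩)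
  rw [hcard₂, natCard_torsionBy_two_pow_eq_of_padicValNat_le hLsha₁, natCard_torsionBy_two_pow_eq_of_padicValNat_le hLsha₂] at h
  exact h

set_option maxHeartbeats 1600000 in
/-- **THE REGISTERED `stub_upper` CONCLUSION `#Ш(E_K)(2) ≤ 2^{2M₀}` (for `M₀ := D.M₀`) MODULO the route's published inputs
(Gross–Zagier all levels, GZK, modularity, Milne) AND the supplier's inputs** (two-member descent data `D`, a Heegner point, a
Heegner datum `d₁` with `y_K` of infinite order, prime `|d_K|`, finiteness of the two `Ш` with `v₂ #Ш ≤ L`, the point-free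
Mordell–Weil kernels): `card_primaryComponent_mul_le_two_pow_of_pairData_cmInert` fed into g16's
`ShaCountTwo.card_primaryComponent_sha_two_baseChange_le_pow_of_pair_le_of_facts` (p705380).
[cite: McCallumLMS1991, §1 Theorem, §5 Thm. 5.4 "≤"] [cite: Milne1972ArithmeticAV, §1 Thm. 1] [cite: Kolyvagin1989Izv, §3] -/
theorem card_primaryComponent_sha_two_baseChange_le_pow_of_pairData_cmInert_of_facts
    -- the route's published inputs (items 24148 / 19921 / 19273 / 24149)
    (hGZ : ∀ (N : ℕ) [NeZero N] (W : WeierstrassCurve ℚ) (K : Type) [Field K] [NumberField K], gross_zagier N W K)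
    (hGZK : rank_eq_analyticRank_of_analyticRank_le_one) (hmod : hasEntireLFunction_rat)
    (hMilneC : Milne1972.bsdQuotient_baseChange_quadratic_anyModel)
    [W.IsElliptic] [W.IsGloballyMinimal] [NeZero (W.conductorNorm ℤ)] [(twin W K).IsElliptic]
    (hCM : W.HasCM) (hin : Literature.NumberTheory.EllipticCurves.Rank1Residual.CMInert W 2)
    (hρ : W.HasSurjectiveModNGaloisRep 2) (hK : IsImaginaryQuadratic K) (hoddK : Odd (NumberField.discr K))
    (hH : SatisfiesHeegnerHypothesis (W.conductorNorm ℤ) K)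
    {P₀ : (W.baseChange K).toAffine.Point} (hP₀ : IsHeegnerPoint (W.conductorNorm ℤ) W K P₀)
    {L : ℕ} (hL1 : 1 ≤ L)
    -- the two-member descent data on the `ℚ`-pair carrier
    (D : PairDataM (galH1Torsion W (lvl (L + L))) (galH1Torsion (twin W K) (lvl (L + L)))
      (HeightOneSpectrum (𝓞 ℚ) ⊕ InfinitePlace ℚ))
    (hDp : D.p = 2) (hDM : D.M = L + L)
    (hDSel₁ : D.Sel₁ = selmerGroup W (lvl (L + L)))
    (hDSel₂ : D.Sel₂ = selmerGroup (twin W K) (lvl (L + L)))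
    (hDLoc₁ : D.Loc₁ = loc₁ W (L + L)) (hDLoc₂ : D.Loc₂ = loc₂ W K (L + L))
    (hDA₁ : D.A₁ = a₁ W (L + L)) (hDA₂ : D.A₂ = a₂ W K (L + L))
    (hDpl : D.pl = pl) (hDDv : D.Dv = Dv)
    (hDKol : ∀ ℓ, D.Kol ℓ ↔ IsKolyvaginPrime (W.conductorNorm ℤ) W K 2 ℓ ∧
      FrobEqFrobInfty W K (2 ^ (L + L + 1)) ℓ ∧ kolPrime W K (L + L) ℓ)
    (hM₀L : D.M₀ ≤ L)
    -- finiteness of the two Tate–Shafarevich groups, `L` beyond their `2`-adic size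
    [Finite W.sha] [Finite (twin W K).sha]
    (hLsha₁ : padicValNat 2 (Nat.card W.sha) ≤ L) (hLsha₂ : padicValNat 2 (Nat.card (twin W K).sha) ≤ L)
    -- rank one on `E`: the kernel of `Sel_{2^{2L}}(E) → H¹(ℚ, E)` is `ℤ · D.x`; rank zero on `E^{(d_K)}`: that kernel vanishes
    (hkerT : ∀ z : selmerGroup W (lvl (L + L)),
      torsionH1ToH1 W (lvl (L + L)) z = 0 ↔ (z : galH1Torsion W (lvl (L + L))) ∈ AddSubgroup.zmultiples D.x)
    (hinjT : ∀ z : selmerGroup (twin W K) (lvl (L + L)), torsionH1ToH1 (twin W K) (lvl (L + L)) z = 0 → z = 0)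
    (hq : (NumberField.discr K).natAbs.Prime)
    (Dt : Literature.NumberTheory.EllipticCurves.ModularForms.ModularParametrizationData W (W.conductorNorm ℤ)) (β : ℤ)
    (ιK : K →+* ℂ) (d₁ : KolyvaginHeegnerData Dt β ιK 1) (hy : ¬ IsOfFinAddOrder d₁.derivedPoint) :
    Nat.card (AddCommGroup.primaryComponent (W.baseChange K).sha 2) ≤ 2 ^ (2 * D.M₀) :=
  ShaCountTwo.card_primaryComponent_sha_two_baseChange_le_pow_of_pair_le_of_facts hGZ hGZK hmod hMilneC W hCM hin hρ K hK hoddK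
    hH hq Dt β ιK d₁ hy
    (card_primaryComponent_mul_le_two_pow_of_pairData_cmInert W hCM hin hρ hK hoddK hH hP₀ hL1 D hDp hDM hDSel₁ hDSel₂ hDLoc₁
      hDLoc₂ hDA₁ hDA₂ hDpl hDDv hDKol hM₀L hLsha₁ hLsha₂ hkerT hinjT)

end Summit.BirchSwinnertonDyer.BirchSwinnertonDyer.Theorems.KolyvaginPairDataTwo

end
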